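import Literature.AlgebraicGeometry.Resolution.AlterationsSemiStable
import Literature.AlgebraicGeometry.Resolution.AlterationsBlowupDivisor
import Literature.AlgebraicGeometry.Resolution.RegularLocalRingsFlatDescent
import HarnessLib

/-!
# De Jong's alteration theorem: resolving a semi-stable pair (de Jong 1996, 4.23–4.28, §3, 2.4)

Topic: `Literature/AlgebraicGeometry/Resolution`. Companion to `AlterationsSemiStable.lean`,
which vendors the last block of the printed proof of de Jong 1996, Thm. 4.1 — 4.23–4.28: Thm. 4.1
with its generically-étale clause for every pair `(X, Z)` in Situation 4.23
(`DeJong1996.SemiStablePair f g D τ`, `Z = ⋃ᵢ τᵢ(Y) ∪ f⁻¹(D)`) — as ONE named fact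
`DeJong1996SemiStablePairResolution`. This file is the first layer of its decomposition, cut
where the printed text cuts (p. 75–76):

> "4.24. Using the modification of Lemma 3.2 we reduce to the situation 4.23, where we have in
> addition that `codim(Sing(X), X) ≥ 3`. (…) The situation is further explained in 3.5. Using
> these explanations we see that we reduce to the situation described in 4.25 below. (…)
> 4.28. By repeatedly blowing up `(X, Z)` as in 4.26 we finally get the situation that `X` is
> nonsingular and `Z` is a normal crossings divisor. It is well known that by blowing up `X`
> further we can reach the situation where `Z` has strict normal crossings, see 2.4. This
> finishes the proof of Theorem 4.1."

Accordingly this file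

* defines **modifications** (de Jong 1996, 2.17: an integral `X'` with a proper birational
  `φ : X' → X`), `IsModification φ`, and proves that a modification is a generically étale
  alteration (2.20, 2.6), that modifications compose, and that the blow-up of an integral
  locally Noetherian scheme in a non-zero ideal sheaf is one;
* defines **normal crossings divisors** (de Jong 1996, 2.4: "there is a surjective étale
  morphism `S' → S` such that the inverse image of `D` is a strict normal crossings divisor on
  `S'`"), `IsNormalCrossingsDivisor X Z`, on closed subsets as `IsStrictNormalCrossingsDivisor`
  (2.2), and proves: strict ⇒ normal crossings, the empty divisor, a normal crossings divisor is
  closed, and the ambient scheme is regular along it (2.4 a) descends along the flat local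
  homomorphisms of an étale cover, Matsumura 23.7 (i));
* vendors the three printed blocks as NAMED FACTS with the source's numbering:
  `DeJong1996SemiStableCodimThree` (4.24 ← Lemma 3.2: a modification over `Y`, with centre in
  `Sing(X)`, to a pair in Situation 4.23 with `codim(Sing(X), X) ≥ 3`),
  `DeJong1996CodimThreeModification` (3.5 and 4.25–4.28, first sentence: a projective
  modification to `X` nonsingular with `Z` a normal crossings divisor), and
  `DeJong1996NormalCrossingsBlowup` (2.4, the "well known" blow-up making a normal crossings
  divisor strict, used in 4.28);
* PROVES the assembly: `DeJong1996.conclusionGenericallyEtale_of_isRegular_of_normalCrossings`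
  (4.28, second sentence: a nonsingular projective variety with a normal crossings divisor
  satisfies the conclusion of Thm. 4.1 with the clause — the blow-up of 2.4 is a generically
  étale alteration, its source is regular, being regular along the strict normal crossings
  divisor and isomorphic to `X` off it, and projective by `BlowupProjectiveOverField`),
  `DeJong1996SemiStablePairResolution.of_codimThree_of_modification_of_blowup` (the target fact
  from the three blocks and the projectivity of blow-ups, each step being a replacement of
  `(X, Z)` by `(X', φ⁻¹Z)` along a generically étale alteration, 4.4), the composite assemblies
  down to `DeJong1996Strong`/`DeJong1996StrongPerfect`/`DeJong1996Projective`, and the sanity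
  implication `DeJong1996StrongAlgClosed →` (conclusion for a regular projective variety with a
  normal crossings divisor): such a pair is a pair as in Thm. 4.1, a normal crossings divisor
  being closed.

The three named facts are nodes to be decomposed further (Lemma 3.2 = 3.3–3.4: the local
structure 2.23 of a semi-stable curve at a node, `B ≅ A⟦u, v⟧/(uv - h)`, and the blow-up of a
codimension-2 component of `Sing(X)` in three charts; 3.5/4.25–4.27: the blow-up of a
nonsingular component of `Sing(X)` in the rings `k⟦u, v, t₁, …, t_{d-1}⟧/(uv - t₁ ⋯ t_μ)`, two
charts; 2.4: blowing up the closures of the strata of branch multiplicity, top down); the owning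
literature unit's `NOTES.md` keeps the DAG.

## Sources

* A. J. de Jong, *Smoothness, semi-stability and alterations*, Publ. Math. IHÉS 83 (1996) 51–93:
  2.2–2.4 (pp. 54–55), 2.6 (p. 55), 2.17, 2.20 (pp. 59–61), 2.23 (pp. 61–62), 3.1–3.5
  (pp. 62–64), Thm. 4.1, 4.4 (p. 66), 4.23–4.28 (pp. 75–76).
* H. Matsumura, *Commutative Ring Theory* (1986), Thm. 23.7 (i) (regularity descends along flat
  local homomorphisms), via `RegularLocalRingsFlatDescent.lean`.
* R. Hartshorne, *Algebraic Geometry* (1977), II Prop. 7.16 (c) (blow-ups of projective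
  varieties are projective), via the named fact `BlowupProjectiveOverField`.
-/

noncomputable section

open CategoryTheory CategoryTheory.Limits AlgebraicGeometry TopologicalSpace Topology

namespace Literature.AlgebraicGeometry.Resolution

universe u

/-! ## Modifications (de Jong 1996, 2.17) -/

/-- **Modification** (de Jong 1996, 2.17): "Let `S` be an integral Noetherian scheme. A
modification `S'` of `S` is an integral scheme `S'`, together with a proper birational
morphism `φ : S' → S`." Rendered for `φ : X' ⟶ X`: `X'` is integral, `φ` is proper, and `φ`
is birational (`IsBirational`, Stacks 01RN: an isomorphism over a dense open of `X` whose
preimage is dense in `X'`). No hypothesis on `X` is built in; the source uses the notion for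
integral Noetherian `X` only. [cite: DeJong1996, 2.17, pp. 59–60] -/
structure IsModification {X' X : Scheme.{u}} (φ : X' ⟶ X) : Prop where
  /-- the source is integral -/
  isIntegral : IsIntegral X'
  /-- `φ` is proper -/
  isProper : IsProper φ
  /-- `φ` is birational -/
  isBirational : IsBirational φ

namespace IsModification

variable {X'' X' X : Scheme.{u}} {ψ : X'' ⟶ X'} {φ : X' ⟶ X}

/-- A modification is dominant. [folklore] -/
theorem isDominant (h : IsModification φ) : IsDominant φ :=
  h.isBirational.isDominant

/-- **A modification is an alteration** (de Jong 1996, 2.20: an alteration is a dominant proper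
`φ` with integral source, finite over a non-empty open; a modification is an isomorphism, in
particular finite, over a dense — hence non-empty — open). [cite: DeJong1996, 2.20, p. 61] -/
theorem isAlteration (h : IsModification φ) : IsAlteration φ := by
  haveI := h.isIntegral
  haveI : Nonempty X := ⟨φ (Classical.arbitrary X')⟩
  obtain ⟨U, hU, -, hiso⟩ := h.isBirational
  exact ⟨h.isIntegral, h.isProper, h.isDominant, U, hU.nonempty, inferInstance⟩

/-- A modification is generically étale (de Jong 1996, 2.6): it is an isomorphism over a dense
open of the target whose preimage is dense. [cite: DeJong1996, 2.20, p. 61] -/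
theorem isGenericallyEtale (h : IsModification φ) : IsGenericallyEtale φ := by
  obtain ⟨U, -, hU', hiso⟩ := h.isBirational
  exact IsGenericallyEtale.of_isIso_morphismRestrict φ U hU'

/-- "A composition of modifications is a modification" (de Jong 1996, 2.17).
[cite: DeJong1996, 2.17, p. 60] -/
theorem comp (hψ : IsModification ψ) (hφ : IsModification φ) : IsModification (ψ ≫ φ) :=
  haveI := hψ.isProper
  haveI := hφ.isProper
  ⟨hψ.isIntegral, inferInstance, hψ.isBirational.comp hφ.isBirational⟩

/-- **A blow-up of an integral locally Noetherian scheme in a non-zero ideal sheaf is a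
modification** (de Jong 1996, 4.8: "Thus `φ` is a modification of `X`"): the source is integral
(Stacks 02ND), `π` is proper (Stacks 02NS) and birational (Stacks 02OS).
[cite: DeJong1996, 4.8, p. 67] -/
theorem of_isBlowup [IsIntegral X] [IsLocallyNoetherian X] {I : X.IdealSheafData}
    (hπ : IsBlowup φ I) (hI : I ≠ ⊥) : IsModification φ :=
  ⟨hπ.isIntegral hI, hπ.isProper, hπ.isBirational' hI⟩

end IsModification

/-! ## Normal crossings divisors (de Jong 1996, 2.4) -/

/-- **Normal crossings divisor** (de Jong 1996, 2.4): "A divisor `D` on `S` is a normal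
crossings divisor if there is a surjective étale morphism `S' → S` such that the inverse image
of `D` is a strict normal crossings divisor on `S'`." As for `IsStrictNormalCrossingsDivisor`
(loc. cit. 2.2: a closed subset is identified with the reduced closed subscheme it carries), a
predicate on a subset `Z` of the scheme `X`: some surjective étale `e : X' → X` pulls `Z` back to
a strict normal crossings divisor `e⁻¹(Z)` of `X'` (with its reduced structure — the preimage of
the reduced structure on `Z`, étale base change preserving reducedness; that `Z` is then itself
an effective Cartier divisor, regular ambient local rings included, descends along the
faithfully flat `e`, so the standing "divisor `D`" of the sentence is not repeated).
[cite: DeJong1996, 2.4, p. 55] -/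
def IsNormalCrossingsDivisor (X : Scheme.{u}) (Z : Set X) : Prop :=
  ∃ (X' : Scheme.{u}) (e : X' ⟶ X), Etale e ∧ Surjective e ∧
    IsStrictNormalCrossingsDivisor X' (e ⁻¹' Z)

/-- A strict normal crossings divisor is a normal crossings divisor (take `S' = S`).
[cite: DeJong1996, 2.4, p. 55] -/
theorem IsStrictNormalCrossingsDivisor.isNormalCrossingsDivisor {X : Scheme.{u}} {Z : Set X}
    (h : IsStrictNormalCrossingsDivisor X Z) : IsNormalCrossingsDivisor X Z :=
  ⟨X, 𝟙 X, inferInstance, inferInstance, by simpa using h⟩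

namespace IsNormalCrossingsDivisor

variable {X : Scheme.{u}} {Z : Set X}

/-- The empty subset is a normal crossings divisor. [folklore] -/
theorem empty (X : Scheme.{u}) : IsNormalCrossingsDivisor X (∅ : Set X) :=
  (IsStrictNormalCrossingsDivisor.empty X).isNormalCrossingsDivisor

/-- A subset with no points is a normal crossings divisor. [folklore] -/
theorem of_eq_empty (h : Z = ∅) : IsNormalCrossingsDivisor X Z := by
  subst h
  exact empty X

/-- A normal crossings divisor is a closed subset: its preimage under the surjective open
(étale) cover is closed. [folklore] -/
theorem isClosed (h : IsNormalCrossingsDivisor X Z) : IsClosed Z := by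
  obtain ⟨X', e, he, hs, hZ⟩ := h
  have h1 : IsOpen (e '' (e ⁻¹' Z)ᶜ) := e.isOpenMap _ hZ.isClosed.isOpen_compl
  rw [← Set.preimage_compl, Set.image_preimage_eq _ e.surjective] at h1
  exact isOpen_compl_iff.mp h1

/-- **The ambient scheme is regular along a normal crossings divisor** (de Jong 1996, 2.4 a)
upstairs, descended: for `p ∈ Z` and `p'` over `p` in the étale cover, `𝒪_{X,p} → 𝒪_{X',p'}`
is a flat local homomorphism of Noetherian local rings with regular target, so `𝒪_{X,p}` is
regular, Matsumura Thm. 23.7 (i)). [cite: DeJong1996, 2.4, p. 55] -/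
theorem isRegularLocalRing [IsLocallyNoetherian X] (h : IsNormalCrossingsDivisor X Z) {p : X}
    (hp : p ∈ Z) : IsRegularLocalRing (X.presheaf.stalk p) := by
  obtain ⟨X', e, he, hs, hZ⟩ := h
  obtain ⟨p', rfl⟩ := e.surjective p
  haveI : IsRegularLocalRing (X'.presheaf.stalk p') := hZ.isRegularLocalRing hp
  exact IsRegularLocalRing.of_flat_ringHom (e.stalkMap p').hom (Flat.stalkMap e p')

end IsNormalCrossingsDivisor

/-! ## 4.24, 4.25–4.28 and 2.4 as named facts -/

/-- NAMED FACT — **de Jong 1996, 4.24 with Lemma 3.2: reduction of a semi-stable pair to one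
with singular locus of codimension `≥ 3`.** Lemma 3.2 (setting 3.1: `S` an excellent regular
scheme, `D ⊂ S` a strict normal crossings divisor, `f : X → S` a semi-stable curve smooth over
`S ∖ D`; "the singular locus `Sing(X)` of the scheme `X` is contained in `Sing(f)`"): "There
exists a projective modification `φ₁ : X₁ → X` with the following properties: (i) The center of
`φ₁` lies in `Sing(X)`. (ii) `X₁` is a semi-stable curve over `S`, smooth over `S ∖ D`.
(iii) `Sing(X₁)` has codimension at least three in `X₁`. (iv) If the curve `X` is split
semi-stable (2.22), then the curve `X₁` is split semi-stable over `S`." Applied in 4.24 to a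
pair in Situation 4.23 (`DeJong1996.SemiStablePair f g D τ` over an algebraically closed `k`,
`S = Y` a nonsingular projective variety): "Using the modification of Lemma 3.2 we reduce [by
4.4: replace `(X, Z)` by `(X₁, φ₁⁻¹(Z))`] to the situation 4.23, where we have in addition that
`codim(Sing(X), X) ≥ 3`. (Of course the sections `τᵢ` still map into the smooth locus of `f`
…)". Rendered: there are a modification `φ : X₁ → X` (`IsModification`; projective, so `X₁`
is again projective over `k`, which is part of `SemiStablePair`), sections `τ₁ᵢ` of `φ ≫ f`
lifting the `τᵢ` (`τ₁ᵢ ≫ φ = τᵢ`), such that (i) `φ` is an isomorphism over every open of `X`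
consisting of regular points, (ii)+4.24 `(φ ≫ f, g, D, τ₁)` is again in Situation 4.23 with
boundary `⋃ᵢ τ₁ᵢ(Y) ∪ (φ ≫ f)⁻¹(D) = φ⁻¹(Z)`, and (iii) every non-regular point `x` of `X₁` has
`dim 𝒪_{X₁,x} ≥ 3` (for the variety `X₁`: `codim(Sing(X₁), X₁) ≥ 3`); (iv) is not rendered
(4.22: "We drop the stability hypothesis"; 4.24: "there we consider only closed points, so that
the situation is automatically split"). Users take `(h : DeJong1996SemiStableCodimThree)`; it
is a node to decompose further (3.3–3.4). [cite: DeJong1996, Lemma 3.2 and 4.24, pp. 62–64, 75] -/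
def DeJong1996SemiStableCodimThree : Prop :=
  ∀ (k : Type u) [Field k] [IsAlgClosed k] (X Y : Scheme.{u}) (f : X ⟶ Y)
    (g : Y ⟶ Spec (.of k)) (D : Set Y) (n : ℕ) (τ : Fin n → (Y ⟶ X)),
    DeJong1996.SemiStablePair f g D τ →
      ∃ (X₁ : Scheme.{u}) (φ : X₁ ⟶ X) (τ₁ : Fin n → (Y ⟶ X₁)),
        IsModification φ ∧
        (∀ U : X.Opens, (∀ x ∈ U, IsRegularLocalRing (X.presheaf.stalk x)) → IsIso (φ ∣_ U)) ∧
        (∀ i, τ₁ i ≫ φ = τ i) ∧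
        DeJong1996.SemiStablePair (φ ≫ f) g D τ₁ ∧
        φ ⁻¹' DeJong1996.semiStableBoundary f D τ =
          DeJong1996.semiStableBoundary (φ ≫ f) D τ₁ ∧
        ∀ x : X₁, ¬ IsRegularLocalRing (X₁.presheaf.stalk x) →
          (3 : WithBot ℕ∞) ≤ ringKrullDim (X₁.presheaf.stalk x)

/-- NAMED FACT — **de Jong 1996, 4.25–4.28 (first sentence) with 3.5: a semi-stable pair with
singular locus of codimension `≥ 3` is resolved, up to normal crossings, by blowing up the
components of the singular locus.** For a pair `(X, Z)` in Situation 4.23 over an algebraically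
closed `k` with `codim(Sing(X), X) ≥ 3` (every non-regular `x` has `dim 𝒪_{X,x} ≥ 3`): "The
situation is further explained in 3.5 [`B ≅ A'⟦u, v⟧/(Q - t₁ ⋯ t_μ)`, `2 ≤ μ ≤ r`, `Sing(X)` of
pure codimension three with regular irreducible components]. Using these explanations we see
that we reduce to the situation described in 4.25 [`X` a projective variety of dimension `d`
over `k`, `Z ⊂ X` a divisor; at a closed point either `X` is nonsingular and `Z` is a normal
crossings divisor (or `x ∉ Z`), or `𝒪̂_{X,x} ≅ k⟦u, v, t₁, …, t_{d-1}⟧/(uv - t₁ ⋯ t_μ)`,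
`2 ≤ μ ≤ r ≤ d - 1`, with `Z = {t₁ ⋯ t_r = 0}`; the components of `Sing(X)` are nonsingular]
… 4.26. Let `E ⊂ X` be an irreducible component of `Sing(X)`. Let `π : X' → X` be the blowing
up of `X` in the ideal sheaf of `E`, and put `Z' = π⁻¹(Z)`. 4.27. Claim. The pair `(X', Z')` is
as described in 4.25. The number of components of `Sing(X')` is one less than the number of
components of `Sing(X)`. [two charts] 4.28. By repeatedly blowing up `(X, Z)` as in 4.26 we
finally get the situation that `X` is nonsingular and `Z` is a normal crossings divisor."
Rendered as the outcome of the iteration: a modification `φ : X' → X` (the composite of the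
blow-ups, each a projective modification of a projective variety) with `X'` projective over
`k`, `X'` regular ("nonsingular", `k` algebraically closed) and `φ⁻¹(Z)` a normal crossings
divisor on `X'` (`IsNormalCrossingsDivisor`, 2.4). Users take
`(h : DeJong1996CodimThreeModification)`; it is a node to decompose further (3.5, 4.25–4.27).
[cite: DeJong1996, 3.5 and 4.24–4.28, pp. 64, 75–76] -/
def DeJong1996CodimThreeModification : Prop :=
  ∀ (k : Type u) [Field k] [IsAlgClosed k] (X Y : Scheme.{u}) (f : X ⟶ Y)
    (g : Y ⟶ Spec (.of k)) (D : Set Y) (n : ℕ) (τ : Fin n → (Y ⟶ X)),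
    DeJong1996.SemiStablePair f g D τ →
      (∀ x : X, ¬ IsRegularLocalRing (X.presheaf.stalk x) →
          (3 : WithBot ℕ∞) ≤ ringKrullDim (X.presheaf.stalk x)) →
        ∃ (X' : Scheme.{u}) (φ : X' ⟶ X), IsModification φ ∧
          Literature.AlgebraicGeometry.Motives.IsProjectiveOver (Over.mk (φ ≫ f ≫ g)) ∧
            Scheme.IsRegular X' ∧
              IsNormalCrossingsDivisor X' (φ ⁻¹' DeJong1996.semiStableBoundary f D τ)

/-- NAMED FACT — **de Jong 1996, 2.4: a normal crossings divisor becomes strict after blowing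
up** ("It is well known that by blowing up `X` further we can reach the situation where `Z` has
strict normal crossings, see 2.4", 4.28). 2.4: "Let `S` be a Noetherian scheme. Let `D ⊂ S` be a
divisor … A divisor `D` on `S` is a normal crossings divisor if there is a surjective étale
morphism `S' → S` such that the inverse image of `D` is a strict normal crossings divisor on
`S'`. In this case there exists a blowing up `φ : S' → S` in an ideal with support in `D` such
that the reduced inverse image `φ⁻¹(D)_red` is a divisor with strict normal crossings on `S'`.
(In case `S` is a surface, blow up the singular points of `D`; in case `S` is a threefold, first
blow up the points where `D` has three branches, then blow up the strict transform of the
curves on `S` where `D` has two branches, etc.)" Rendered for Noetherian schemes `S` of finite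
dimension (the parenthetical procedure runs down the number of branches at a point, which is
bounded by the dimension; this covers 4.28, where `S` is a variety): for a normal crossings
divisor `D ⊆ S` (`IsNormalCrossingsDivisor`) there are a blow-up `φ : S' → S` of `S` in an ideal
sheaf `I` (`IsBlowup φ I`) with `supp(𝒪_S/I) ⊆ D` such that the closed subset `φ⁻¹(D) ⊆ S'` is
a strict normal crossings divisor (`IsStrictNormalCrossingsDivisor`, on the reduced structure).
Users take `(h : DeJong1996NormalCrossingsBlowup)`; it is a node to decompose further.
[cite: DeJong1996, 2.4, p. 55] -/
def DeJong1996NormalCrossingsBlowup : Prop :=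
  ∀ (S : Scheme.{u}) [IsNoetherian S] (d : ℕ), topologicalKrullDim S ≤ d →
    ∀ (D : Set S), IsNormalCrossingsDivisor S D →
      ∃ (S' : Scheme.{u}) (φ : S' ⟶ S) (I : S.IdealSheafData), IsBlowup φ I ∧
        (I.support : Set S) ⊆ D ∧ IsStrictNormalCrossingsDivisor S' (φ ⁻¹' D)

/-! ## 4.28, second sentence: nonsingular projective `X` with a normal crossings divisor -/

namespace DeJong1996

/-- A blow-up of a regular scheme whose centre has support inside a closed subset `Z` is
regular as soon as it is regular along the preimage of `Z`: off `φ⁻¹(Z)` it is isomorphic to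
`X`. [folklore] -/
theorem isRegular_of_isBlowup_of_support_subset {X' X : Scheme.{u}} {φ : X' ⟶ X}
    {I : X.IdealSheafData} (hφ : IsBlowup φ I) {Z : Set X} (hI : (I.support : Set X) ⊆ Z)
    (hX : Scheme.IsRegular X)
    (hZ : ∀ x : X', φ x ∈ Z → IsRegularLocalRing (X'.presheaf.stalk x)) :
    Scheme.IsRegular X' := by
  intro x
  by_cases hx : φ x ∈ Z
  · exact hZ x hx
  · -- over the complement `U` of the centre `φ` is an isomorphism
    have hxU : φ x ∈ centreCompl I := fun h => hx (hI h)
    haveI : IsIso (φ ∣_ centreCompl I) := hφ.isIso_compl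
    let y : ↥(φ ⁻¹ᵁ centreCompl I) := ⟨x, hxU⟩
    -- `𝒪_{X', x} ≅ 𝒪_{φ⁻¹U, y} ≅ 𝒪_{U, φ y} ≅ 𝒪_{X, φ x}`
    have e₁ := (asIso ((φ ⁻¹ᵁ centreCompl I).ι.stalkMap y)).commRingCatIsoToRingEquiv
    have e₂ := (asIso ((φ ∣_ centreCompl I).stalkMap y)).commRingCatIsoToRingEquiv
    have e₃ := (asIso ((centreCompl I).ι.stalkMap
      ((φ ∣_ centreCompl I) y))).commRingCatIsoToRingEquiv
    haveI := hX ((centreCompl I).ι ((φ ∣_ centreCompl I) y))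
    haveI : IsRegularLocalRing ((φ ⁻¹ᵁ centreCompl I).toScheme.presheaf.stalk y) :=
      IsRegularLocalRing.of_ringEquiv (e₃.trans e₂)
    exact IsRegularLocalRing.of_ringEquiv e₁.symm

/-- A projective scheme over a field is Noetherian (proper, hence quasi-compact and of finite
type over a field). [folklore] -/
theorem isNoetherian_of_isProjectiveOver {k : Type u} [Field k] {X : Scheme.{u}}
    (f : X ⟶ Spec (.of k)) (hproj : Literature.AlgebraicGeometry.Motives.IsProjectiveOver (Over.mk f)) :
    IsNoetherian X := by
  haveI : IsProper f :=
    Literature.AlgebraicGeometry.Motives.IsProjectiveOver.isProper (X := Over.mk f) hproj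
  have hq : QuasiCompact f := inferInstance
  haveI : CompactSpace X := (HasAffineProperty.iff_of_isAffine (P := @QuasiCompact)).mp hq
  exact { __ := LocallyOfFiniteType.isLocallyNoetherian f }

/-- **de Jong 1996, 4.28, second sentence, as a theorem**: over an algebraically closed field
`k`, a nonsingular (regular) projective variety `X` with a normal crossings divisor `Z ⊊ X`
satisfies the conclusion of Thm. 4.1 with its generically-étale clause — given the blow-up of
2.4 (`DeJong1996NormalCrossingsBlowup`) and the projectivity of blow-ups
(`BlowupProjectiveOverField`): "It is well known that by blowing up `X` further we can reach the
situation where `Z` has strict normal crossings, see 2.4. This finishes the proof of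
Theorem 4.1." The blow-up `φ : X' → X` in an ideal `I ≠ 0` (its support lies in `Z ∌ η_X`) is a
modification, hence a generically étale alteration; `X'` is projective, integral, and regular
(regular along the strict normal crossings divisor `φ⁻¹(Z)`, isomorphic to `X` off it); take
`X₁ = X̄₁ = X'`, `φ₁ = φ`, `j₁ = 𝟙`. [cite: DeJong1996, 4.28, p. 76] -/
theorem conclusionGenericallyEtale_of_isRegular_of_normalCrossings
    (hB : DeJong1996NormalCrossingsBlowup.{u}) (hP : BlowupProjectiveOverField.{u}) {k : Type u}
    [Field k] [IsAlgClosed k] {X : Scheme.{u}} (f : X ⟶ Spec (.of k)) [IsIntegral X]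
    (hproj : Literature.AlgebraicGeometry.Motives.IsProjectiveOver (Over.mk f))
    (hreg : Scheme.IsRegular X) {Z : Set X} (hZ : IsNormalCrossingsDivisor X Z)
    (hZ' : Z ≠ Set.univ) : ConclusionGenericallyEtale f Z := by
  haveI : IsNoetherian X := isNoetherian_of_isProjectiveOver f hproj
  haveI : IsProper f :=
    Literature.AlgebraicGeometry.Motives.IsProjectiveOver.isProper (X := Over.mk f) hproj
  -- `X` is finite-dimensional
  obtain ⟨d, hd⟩ := exists_topologicalKrullDim_le_of_locallyOfFiniteType f
  -- 2.4: blow up inside `Z` to make `Z` strict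
  obtain ⟨X', φ, I, hφ, hIZ, hsnc⟩ := hB X d hd Z hZ
  -- the centre is not everything: `η_X ∉ Z`
  have hη : genericPoint X ∉ Z := by
    intro hη
    have hsub := ((genericPoint_spec X).mem_closed_set_iff hZ.isClosed).mp hη
    exact hZ' (Set.eq_univ_of_univ_subset (by simpa using hsub))
  have hI : I ≠ ⊥ := by
    intro hI0
    apply hη
    apply hIZ
    rw [hI0, Scheme.IdealSheafData.support_bot]
    trivial
  have hmod : IsModification φ := IsModification.of_isBlowup hφ hI
  haveI := hmod.isIntegral
  have hreg' : Scheme.IsRegular X' :=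
    isRegular_of_isBlowup_of_support_subset hφ hIZ hreg fun x hx => hsnc.isRegularLocalRing hx
  refine ⟨X', X', φ, 𝟙 X', φ ≫ f, hmod.isAlteration, inferInstance, inferInstance,
    hP k X X' f I φ ‹_› hproj hI hφ, hreg', by simp, ?_, hmod.isGenericallyEtale⟩
  have : ((𝟙 X' : X' ⟶ X') '' (φ ⁻¹' Z) ∪ (Set.range (𝟙 X' : X' ⟶ X'))ᶜ : Set X') = φ ⁻¹' Z := by
    ext x
    simp
  rw [this]
  exact hsnc

end DeJong1996

/-! ## The assembly -/

/-- **de Jong 1996, 4.25–4.28 assembled**: for pairs in Situation 4.23 with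
`codim(Sing(X), X) ≥ 3`, Thm. 4.1 with its generically-étale clause follows from the
modification of 4.25–4.28 (`DeJong1996CodimThreeModification`), the blow-up of 2.4
(`DeJong1996NormalCrossingsBlowup`) and the projectivity of blow-ups
(`BlowupProjectiveOverField`), by 4.4 (`ConclusionGenericallyEtale.of_isAlteration`).
[cite: DeJong1996, 4.24–4.28, pp. 75–76] -/
theorem DeJong1996.SemiStablePair.conclusionGenericallyEtale_of_codimThree
    (hA : DeJong1996CodimThreeModification.{u}) (hB : DeJong1996NormalCrossingsBlowup.{u})
    (hP : BlowupProjectiveOverField.{u}) {k : Type u} [Field k] [IsAlgClosed k]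
    {X Y : Scheme.{u}} {f : X ⟶ Y} {g : Y ⟶ Spec (.of k)} {D : Set Y} {n : ℕ}
    {τ : Fin n → (Y ⟶ X)} (h : DeJong1996.SemiStablePair f g D τ)
    (hcodim : ∀ x : X, ¬ IsRegularLocalRing (X.presheaf.stalk x) →
      (3 : WithBot ℕ∞) ≤ ringKrullDim (X.presheaf.stalk x)) :
    DeJong1996.ConclusionGenericallyEtale (f ≫ g) (DeJong1996.semiStableBoundary f D τ) := by
  haveI := h.isIntegral
  obtain ⟨X', φ, hφ, hproj, hreg, hnc⟩ := hA k X Y f g D n τ h hcodim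
  haveI := hφ.isIntegral
  apply DeJong1996.ConclusionGenericallyEtale.of_isAlteration hφ.isAlteration hφ.isGenericallyEtale
  refine DeJong1996.conclusionGenericallyEtale_of_isRegular_of_normalCrossings hB hP (φ ≫ f ≫ g)
    hproj hreg hnc ?_
  -- `φ⁻¹(Z) ≠ X'`: the generic point of `X'` lies over the generic point of `X`, off `Z`
  intro hZ
  have hη : genericPoint X' ∈ φ ⁻¹' DeJong1996.semiStableBoundary f D τ := hZ ▸ Set.mem_univ _
  haveI := hφ.isDominant
  rw [Set.mem_preimage, genericPoint_eq_of_isDominant φ] at hη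
  exact h.genericPoint_notMem_semiStableBoundary hη

/-- **de Jong 1996, 4.23–4.28 from its three printed blocks**: the reduction to codimension-3
singularities (4.24 with Lemma 3.2, `DeJong1996SemiStableCodimThree`), the blow-ups 4.25–4.28
(`DeJong1996CodimThreeModification`), and the strictification of 2.4
(`DeJong1996NormalCrossingsBlowup`), together with the projectivity of blow-ups
(`BlowupProjectiveOverField`, Hartshorne II 7.16 (c)), give `DeJong1996SemiStablePairResolution`.
Each step replaces `(X, Z)` by `(X', φ⁻¹Z)` along a generically étale alteration (4.4).
[cite: DeJong1996, 4.23–4.28, pp. 75–76] -/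
theorem DeJong1996SemiStablePairResolution.of_codimThree_of_modification_of_blowup
    (h₁ : DeJong1996SemiStableCodimThree.{u}) (h₂ : DeJong1996CodimThreeModification.{u})
    (h₃ : DeJong1996NormalCrossingsBlowup.{u}) (hP : BlowupProjectiveOverField.{u}) :
    DeJong1996SemiStablePairResolution.{u} := by
  intro k _ _ X Y f g D n τ h
  haveI := h.isIntegral
  obtain ⟨X₁, φ, τ₁, hφ, -, -, h₁', hZ, hcodim⟩ := h₁ k X Y f g D n τ h
  haveI := hφ.isIntegral
  apply DeJong1996.ConclusionGenericallyEtale.of_isAlteration hφ.isAlteration hφ.isGenericallyEtale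
  rw [hZ, ← Category.assoc]
  exact h₁'.conclusionGenericallyEtale_of_codimThree h₂ h₃ hP hcodim

/-- The step 4.11–4.28 for normal projective pairs (`DeJong1996NormalProjectiveStep`) from
4.11–4.22 (`DeJong1996ReductionToSemiStablePair`) and the three blocks of 4.23–4.28.
[cite: DeJong1996, 4.11–4.28, pp. 67–76] -/
theorem DeJong1996NormalProjectiveStep.of_semiStableBlocks
    (hred : DeJong1996ReductionToSemiStablePair.{u}) (h₁ : DeJong1996SemiStableCodimThree.{u})
    (h₂ : DeJong1996CodimThreeModification.{u}) (h₃ : DeJong1996NormalCrossingsBlowup.{u})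
    (hP : BlowupProjectiveOverField.{u}) : DeJong1996NormalProjectiveStep.{u} :=
  DeJong1996NormalProjectiveStep.of_semiStablePair hred
    (DeJong1996SemiStablePairResolution.of_codimThree_of_modification_of_blowup h₁ h₂ h₃ hP)

/-- Over an algebraically closed field: 4.3, 4.6–4.10, 4.11–4.22 and the three blocks of
4.23–4.28 give Thm. 4.1 with its generically-étale clause in every dimension.
[cite: DeJong1996, 4.3–4.28, pp. 66–76] -/
theorem DeJong1996StrongAlgClosed.of_reduction_of_semiStableBlocks
    (hnp : DeJong1996NormalProjectiveReduction.{u}) (hred : DeJong1996ReductionToSemiStablePair.{u})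
    (h₁ : DeJong1996SemiStableCodimThree.{u}) (h₂ : DeJong1996CodimThreeModification.{u})
    (h₃ : DeJong1996NormalCrossingsBlowup.{u}) (hP : BlowupProjectiveOverField.{u}) :
    DeJong1996StrongAlgClosed.{u} :=
  DeJong1996StrongAlgClosed.of_reduction_of_semiStablePair hnp hred
    (DeJong1996SemiStablePairResolution.of_codimThree_of_modification_of_blowup h₁ h₂ h₃ hP)

/-- **Assembly of the printed proof of Thm. 4.1** from 4.5 (`DeJong1996Descent`), 4.6–4.10
(`DeJong1996NormalProjectiveReduction`), 4.11–4.22 (`DeJong1996ReductionToSemiStablePair`), the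
three blocks of 4.23–4.28 and the projectivity of blow-ups. [cite: DeJong1996, 4.3–4.28, pp. 66–76] -/
theorem DeJong1996Strong.of_descent_of_reduction_of_semiStableBlocks (h45 : DeJong1996Descent.{u})
    (hnp : DeJong1996NormalProjectiveReduction.{u}) (hred : DeJong1996ReductionToSemiStablePair.{u})
    (h₁ : DeJong1996SemiStableCodimThree.{u}) (h₂ : DeJong1996CodimThreeModification.{u})
    (h₃ : DeJong1996NormalCrossingsBlowup.{u}) (hP : BlowupProjectiveOverField.{u}) :
    DeJong1996Strong.{u} :=
  DeJong1996Strong.of_descent_of_reduction_of_semiStablePair h45 hnp hred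
    (DeJong1996SemiStablePairResolution.of_codimThree_of_modification_of_blowup h₁ h₂ h₃ hP)

/-- The same assembly gives the last sentence of Thm. 4.1 (perfect ground fields).
[cite: DeJong1996, 4.3–4.28, pp. 66–76] -/
theorem DeJong1996StrongPerfect.of_descent_of_reduction_of_semiStableBlocks
    (h45 : DeJong1996Descent.{u}) (hnp : DeJong1996NormalProjectiveReduction.{u})
    (hred : DeJong1996ReductionToSemiStablePair.{u}) (h₁ : DeJong1996SemiStableCodimThree.{u})
    (h₂ : DeJong1996CodimThreeModification.{u}) (h₃ : DeJong1996NormalCrossingsBlowup.{u})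
    (hP : BlowupProjectiveOverField.{u}) : DeJong1996StrongPerfect.{u} :=
  DeJong1996StrongPerfect.of_descent_of_reduction_of_semiStablePair h45 hnp hred
    (DeJong1996SemiStablePairResolution.of_codimThree_of_modification_of_blowup h₁ h₂ h₃ hP)

/-- `DeJong1996Projective` (Thm. 4.1 (i)) from the same blocks. [cite: DeJong1996, Thm. 4.1, p. 66] -/
theorem DeJong1996Projective.of_descent_of_reduction_of_semiStableBlocks (h45 : DeJong1996Descent.{u})
    (hnp : DeJong1996NormalProjectiveReduction.{u}) (hred : DeJong1996ReductionToSemiStablePair.{u})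
    (h₁ : DeJong1996SemiStableCodimThree.{u}) (h₂ : DeJong1996CodimThreeModification.{u})
    (h₃ : DeJong1996NormalCrossingsBlowup.{u}) (hP : BlowupProjectiveOverField.{u}) :
    DeJong1996Projective.{u} :=
  (DeJong1996Strong.of_descent_of_reduction_of_semiStableBlocks h45 hnp hred h₁ h₂ h₃ hP).projective

/-! ## Sanity of the cut -/

/-- Sanity of the cut at 4.28: a regular projective variety `X` over an algebraically closed
field with a normal crossings divisor `Z ⊊ X` is a pair as in Thm. 4.1 (`X` integral, separated
of finite type over `k`; `Z` closed — `IsNormalCrossingsDivisor.isClosed` — and proper), so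
Thm. 4.1 with its clause over algebraically closed fields (`DeJong1996StrongAlgClosed`) serves
the situation of `conclusionGenericallyEtale_of_isRegular_of_normalCrossings`. [folklore] -/
theorem DeJong1996.conclusionGenericallyEtale_of_normalCrossings_of_strongAlgClosed
    (H : DeJong1996StrongAlgClosed.{u}) {k : Type u} [Field k] [IsAlgClosed k] {X : Scheme.{u}}
    (f : X ⟶ Spec (.of k)) [IsIntegral X]
    (hproj : Literature.AlgebraicGeometry.Motives.IsProjectiveOver (Over.mk f)) {Z : Set X}
    (hZ : IsNormalCrossingsDivisor X Z) (hZ' : Z ≠ Set.univ) :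
    DeJong1996.ConclusionGenericallyEtale f Z :=
  haveI : IsProper f :=
    Literature.AlgebraicGeometry.Motives.IsProjectiveOver.isProper (X := Over.mk f) hproj
  H k X f Z inferInstance inferInstance inferInstance ‹_› hZ.isClosed hZ'

end Literature.AlgebraicGeometry.Resolution

end
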